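import Summits.NavierStokesRegularity.NavierStokesRegularity.Theses.ExtremalTypeIConstant
import Summits.NavierStokesRegularity.NavierStokesRegularity.Theorems.ExtremalTypeIConstantSpiralScalingLiouvilleWindow
import Summits.NavierStokesRegularity.NavierStokesRegularity.Theorems.ExtremalTypeIConstantSpiralScalingLiouvilleStubRateZero
import Summits.NavierStokesRegularity.NavierStokesRegularity.Theorems.ExtremalTypeIConstantSpiralScalingLiouvilleStubProfileAxisNormalForm
import Summits.NavierStokesRegularity.NavierStokesRegularity.Theorems.ExtremalTypeIConstantSpiralScalingLiouvilleStubPvClassOfProfile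
import Summits.NavierStokesRegularity.NavierStokesRegularity.Theorems.TypeICertificateLadderTargetSolitonLawsProfile
import Literature.Analysis.FluidPDE.PineauVicolRSSChaeWolf
import Literature.Analysis.FluidPDE.SwirlTransportProofs
import HarnessLib

/-!
# Route `ExtremalTypeIConstant`, crux `SpiralScalingLiouville` (stmt-NavierStokesRegularity-8216), line `registered`:
# the PROFILE-FORM Liouville statement of the birth skeleton (stub 2) is EQUIVALENT to the crux — kernel-checked

Summits-side theorem file (kind = proof, no definitions), lead c1. The birth skeleton of the crux
(`Cruxes/SpiralScalingLiouville/Lines/birth.lean`) isolates, as its load-bearing stub 2 `stub_rotatedProfileLiouville`,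
Liouville for the ROTATED LERAY PROFILE SYSTEM in the Type-I decay class: a smooth divergence-free `U` on `ℝ³` solving
`−ΔU + ½U + ½DU[y + Ay] − ½AU + DU[U] + ∇P = 0` with a `C¹` pressure, a skew rate `A` (any axis, any rate, `A = 0`
allowed) and `‖U(y)‖ ≤ K/(‖y‖ + 1)` vanishes. This file proves that statement EQUIVALENT to Pineau–Vicol's
Conjecture 1.1 in their class for all rates, hence (tree: `spiralScalingLiouville_iff_rssLiouvillePV`) to the crux:

* `rssLiouvillePV_of_rotatedProfileLiouville` — profile form ⇒ P–V form: the `t = −1` slice of a classical Type-I RSS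
  solution solves the profile system with `A = −2αJ` and a smooth pressure (tree: `rss_profile_system`) and inherits
  the decay with the apex constant (tree: `PineauVicol2026.profile_bound_of_typeI`);
* `rotatedProfileLiouville_of_rssLiouvillePV` — P–V form ⇒ profile form: `A = 0` is the landed rate-zero leaf
  (`stub_rotatedProfileLiouvilleRateZero`, Tsai 1998); `A ≠ 0` is conjugated to P–V's normal form
  (`stub_profileAxisNormalForm`), realised as a classical Type-I RSS solution of P–V's class (`stub_pvClassOfProfile`),
  and killed by the hypothesis;
* `rotatedProfileLiouville_iff_spiralScalingLiouville` — hence stub 2 ⇔ the crux (⇔ stmt-4053 ⇔ B5b of stmt-1217);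
* `spiralScalingLiouville_of_rotatedProfileLiouville` — the crux BY NAME from stub 2 (CONDITIONAL; stub 2 is open on the
  window `α ≈ 1`).

References: Pineau–Vicol arXiv:2607.09619 (1.7)–(1.10), Conj. 1.1, Remark 1.2, Thm 1.4; Tsai, ARMA 143 (1998) Thm 1.
-/

noncomputable section

set_option linter.dupNamespace false

open Set Function
open scoped ContDiff Laplacian RealInnerProductSpace
open Literature.Analysis.FluidPDE
open Summit.NavierStokesRegularity.NavierStokesRegularity.Theses.ExtremalTypeIConstant
open Summit.NavierStokesRegularity.NavierStokesRegularity.Theorems.SpiralScalingLiouville.Birth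

namespace Summit.NavierStokesRegularity.NavierStokesRegularity.Theorems

/-- **Profile-form Liouville ⇒ Pineau–Vicol's Conjecture 1.1 in their class, all rates.** If every smooth
divergence-free solution of the rotated Leray profile system (any skew rate `A`) with a `C¹` pressure and the decay
`‖U(y)‖ ≤ K/(‖y‖ + 1)` vanishes, then every classical Type-I rotated self-similar solution of Pineau–Vicol's class on
`[−1, 0)` has trivial profile: its `t = −1` slice solves the system with `A = −2αJ` (`rss_profile_system`) and has the
decay with the apex constant (`profile_bound_of_typeI`, Remark 1.2).
[cite: PineauVicol2026, (1.7)–(1.10) and Remark 1.2 (arXiv:2607.09619 pp. 3–4)] -/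
theorem rssLiouvillePV_of_rotatedProfileLiouville
    (h2 : ∀ (A : EuclideanSpace ℝ (Fin 3) →L[ℝ] EuclideanSpace ℝ (Fin 3)), (∀ x, inner ℝ (A x) x = 0) →
      ∀ (U : EuclideanSpace ℝ (Fin 3) → EuclideanSpace ℝ (Fin 3)) (P : EuclideanSpace ℝ (Fin 3) → ℝ),
        ContDiff ℝ ∞ U → ContDiff ℝ 1 P → VectorCalculus.IsDivFree U →
        (∀ y, -((Δ U) y) + (1 / 2 : ℝ) • U y + (1 / 2 : ℝ) • fderiv ℝ U y (y + A y)
            - (1 / 2 : ℝ) • A (U y) + convect U U y + gradient P y = 0) →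
        (∃ K : ℝ, ∀ y, ‖U y‖ ≤ K / (‖y‖ + 1)) → U = 0) :
    ∀ C₀ : ℝ, 0 < C₀ → ∀ (α : ℝ) (u : ℝ → EuclideanSpace ℝ (Fin 3) → EuclideanSpace ℝ (Fin 3)) (p : ℝ → EuclideanSpace ℝ (Fin 3) → ℝ) (U : EuclideanSpace ℝ (Fin 3) → EuclideanSpace ℝ (Fin 3)), Literature.Analysis.FluidPDE.IsClassicalNSSolutionOn (Set.Ico (-1) 0) 1 0 u p → (∀ t ∈ Set.Ico (-1 : ℝ) 0, ∀ x : EuclideanSpace ℝ (Fin 3), ‖u t x‖ ≤ C₀ / (‖x‖ + Real.sqrt (-t))) → ContDiff ℝ 2 U → (∀ t ∈ Set.Ico (-1 : ℝ) 0, ∀ x : EuclideanSpace ℝ (Fin 3), u t x = Literature.Analysis.FluidPDE.pvAnsatz α (fun y _ => U y) t x) → U = 0 := by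
  intro C₀ _ α u p U hsol hI _ hA
  obtain ⟨P, hUs, hPs, hdiv, heq⟩ := rss_profile_system α u p U hsol hA
  have hdec : ∃ K : ℝ, ∀ y, ‖U y‖ ≤ K / (‖y‖ + 1) :=
    ⟨C₀, fun y => profile_bound_of_typeI hI hA y⟩
  refine h2 ((-2 * α) • rotGenL) (fun x => ?_) U P hUs (contDiff_infty.1 hPs 1) hdiv (fun y => ?_) hdec
  · simp [real_inner_smul_left, inner_rotGen_self]
  · have key := heq y
    have e1 : fderiv ℝ U y (y + ((-2 * α) • rotGenL) y) =
        fderiv ℝ U y y + (-2 * α) • fderiv ℝ U y (rotGen y) := by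
      rw [map_add, FunLike.coe_smul, Pi.smul_apply, map_smul, rotGenL_apply]
    have e2 : ((-2 * α) • rotGenL) (U y) = (-2 * α) • rotGen (U y) := by
      rw [FunLike.coe_smul, Pi.smul_apply, rotGenL_apply]
    rw [e1, e2, convect_apply]
    linear_combination (norm := module) key

/-- **Pineau–Vicol's Conjecture 1.1 in their class (all rates) ⇒ profile-form Liouville.** `A = 0`: the landed
rate-zero leaf `stub_rotatedProfileLiouvilleRateZero` (Tsai 1998 Thm 1 at `q = ∞` plus decay). `A ≠ 0`: conjugate to
the normal form `A ↦ −2αJ` by a linear isometry (`stub_profileAxisNormalForm`); a non-positive decay constant forces the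
profile to vanish outright; otherwise the conjugate profile generates a classical Type-I RSS solution of Pineau–Vicol's
class on `[−1, 0)` with apex constant `K` (`stub_pvClassOfProfile`), trivial by hypothesis; undo the conjugation.
[cite: PineauVicol2026, (1.7)–(1.10) (arXiv:2607.09619 p. 3); Tsai1998, Thm 1 (p. 31)] -/
theorem rotatedProfileLiouville_of_rssLiouvillePV
    (hPV : ∀ C₀ : ℝ, 0 < C₀ → ∀ (α : ℝ) (u : ℝ → EuclideanSpace ℝ (Fin 3) → EuclideanSpace ℝ (Fin 3)) (p : ℝ → EuclideanSpace ℝ (Fin 3) → ℝ) (U : EuclideanSpace ℝ (Fin 3) → EuclideanSpace ℝ (Fin 3)), Literature.Analysis.FluidPDE.IsClassicalNSSolutionOn (Set.Ico (-1) 0) 1 0 u p → (∀ t ∈ Set.Ico (-1 : ℝ) 0, ∀ x : EuclideanSpace ℝ (Fin 3), ‖u t x‖ ≤ C₀ / (‖x‖ + Real.sqrt (-t))) → ContDiff ℝ 2 U → (∀ t ∈ Set.Ico (-1 : ℝ) 0, ∀ x : EuclideanSpace ℝ (Fin 3), u t x = Literature.Analysis.FluidPDE.pvAnsatz α (fun y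 _ => U y) t x) → U = 0) :
    ∀ (A : EuclideanSpace ℝ (Fin 3) →L[ℝ] EuclideanSpace ℝ (Fin 3)), (∀ x, inner ℝ (A x) x = 0) →
      ∀ (U : EuclideanSpace ℝ (Fin 3) → EuclideanSpace ℝ (Fin 3)) (P : EuclideanSpace ℝ (Fin 3) → ℝ),
        ContDiff ℝ ∞ U → ContDiff ℝ 1 P → VectorCalculus.IsDivFree U →
        (∀ y, -((Δ U) y) + (1 / 2 : ℝ) • U y + (1 / 2 : ℝ) • fderiv ℝ U y (y + A y)
            - (1 / 2 : ℝ) • A (U y) + convect U U y + gradient P y = 0) →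
        (∃ K : ℝ, ∀ y, ‖U y‖ ≤ K / (‖y‖ + 1)) → U = 0 := by
  intro A hA U P hU hP hdiv heq hdec
  rcases eq_or_ne A 0 with rfl | hA0
  · refine stub_rotatedProfileLiouvilleRateZero U P hU hP hdiv (fun y => ?_) hdec
    simpa only [zero_apply, add_zero, smul_zero, sub_zero] using heq y
  · obtain ⟨K, hK⟩ := hdec
    obtain ⟨L, α, V, Q, _hα, hV, hQ, hVdiv, hVeq, hVK, hVU⟩ :=
      stub_profileAxisNormalForm A hA hA0 U P hU hP hdiv heq K hK
    -- the conjugate profile vanishes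
    have hV0 : V = 0 := by
      rcases le_or_gt K 0 with hK0 | hK0
      · funext y
        exact norm_le_zero_iff.1 ((hVK y).trans (div_nonpos_of_nonpos_of_nonneg hK0 (by positivity)))
      · obtain ⟨p, hns, hI⟩ := stub_pvClassOfProfile α V Q hV hQ hVdiv hVeq K hVK
        exact hPV K hK0 α (pvAnsatz α (fun y _ => V y)) p V hns hI (contDiff_infty.1 hV 2) (fun _ _ _ => rfl)
    -- undo the conjugation
    funext z
    have h1 := hVU (L z)
    rw [hV0, Pi.zero_apply, LinearIsometryEquiv.symm_apply_apply] at h1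
    have h2 : U z = L.symm 0 := by rw [h1, LinearIsometryEquiv.symm_apply_apply]
    rw [h2, map_zero, Pi.zero_apply]

/-- **Profile-form Liouville (stub 2 of the birth skeleton) ⇔ Pineau–Vicol's Conjecture 1.1 in their class, all
rates.** [cite: PineauVicol2026, Conjecture 1.1 (arXiv:2607.09619 p. 3)] -/
theorem rotatedProfileLiouville_iff_rssLiouvillePV :
    (∀ (A : EuclideanSpace ℝ (Fin 3) →L[ℝ] EuclideanSpace ℝ (Fin 3)), (∀ x, inner ℝ (A x) x = 0) →
      ∀ (U : EuclideanSpace ℝ (Fin 3) → EuclideanSpace ℝ (Fin 3)) (P : EuclideanSpace ℝ (Fin 3) → ℝ),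
        ContDiff ℝ ∞ U → ContDiff ℝ 1 P → VectorCalculus.IsDivFree U →
        (∀ y, -((Δ U) y) + (1 / 2 : ℝ) • U y + (1 / 2 : ℝ) • fderiv ℝ U y (y + A y)
            - (1 / 2 : ℝ) • A (U y) + convect U U y + gradient P y = 0) →
        (∃ K : ℝ, ∀ y, ‖U y‖ ≤ K / (‖y‖ + 1)) → U = 0) ↔
    ∀ C₀ : ℝ, 0 < C₀ → ∀ (α : ℝ) (u : ℝ → EuclideanSpace ℝ (Fin 3) → EuclideanSpace ℝ (Fin 3)) (p : ℝ → EuclideanSpace ℝ (Fin 3) → ℝ) (U : EuclideanSpace ℝ (Fin 3) → EuclideanSpace ℝ (Fin 3)), Literature.Analysis.FluidPDE.IsClassicalNSSolutionOn (Set.Ico (-1) 0) 1 0 u p → (∀ t ∈ Set.Ico (-1 : ℝ) 0, ∀ x : EuclideanSpace ℝ (Fin 3), ‖u t x‖ ≤ C₀ / (‖x‖ + Real.sqrt (-t))) → ContDiff ℝ 2 U → (∀ t ∈ Set.Ico (-1 : ℝ) 0, ∀ x : EuclideanSpace ℝ (Fin 3), u t x = Literature.Analysis.FluidPDE.pvAnsatz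 α (fun y _ => U y) t x) → U = 0 :=
  ⟨rssLiouvillePV_of_rotatedProfileLiouville, rotatedProfileLiouville_of_rssLiouvillePV⟩

/-- **Stub 2 of the birth skeleton ⇔ the crux `SpiralScalingLiouville`** (⇔ stmt-4053 ⇔ window stub B5b of
stmt-1217, by `ExtremalTypeIConstantSpiralScalingLiouvilleCore/Window.lean`): the profile-form Liouville statement for
the rotated Leray system in the Type-I decay class is EXACTLY crux-strength. [cite: PineauVicol2026, Conjecture 1.1 (arXiv:2607.09619 p. 3)] -/
theorem rotatedProfileLiouville_iff_spiralScalingLiouville :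
    (∀ (A : EuclideanSpace ℝ (Fin 3) →L[ℝ] EuclideanSpace ℝ (Fin 3)), (∀ x, inner ℝ (A x) x = 0) →
      ∀ (U : EuclideanSpace ℝ (Fin 3) → EuclideanSpace ℝ (Fin 3)) (P : EuclideanSpace ℝ (Fin 3) → ℝ),
        ContDiff ℝ ∞ U → ContDiff ℝ 1 P → VectorCalculus.IsDivFree U →
        (∀ y, -((Δ U) y) + (1 / 2 : ℝ) • U y + (1 / 2 : ℝ) • fderiv ℝ U y (y + A y)
            - (1 / 2 : ℝ) • A (U y) + convect U U y + gradient P y = 0) →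
        (∃ K : ℝ, ∀ y, ‖U y‖ ≤ K / (‖y‖ + 1)) → U = 0) ↔
    SpiralScalingLiouville :=
  rotatedProfileLiouville_iff_rssLiouvillePV.trans spiralScalingLiouville_iff_rssLiouvillePV.symm

/-- **The crux `SpiralScalingLiouville` (stmt-NavierStokesRegularity-8216) BY NAME from the profile-form Liouville
statement** (stub 2 of the birth skeleton; OPEN on the window `α ≈ 1`). CONDITIONAL; nothing here closes the item.
[cite: PineauVicol2026, Conjecture 1.1 (arXiv:2607.09619 p. 3)] -/
theorem spiralScalingLiouville_of_rotatedProfileLiouville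
    (h2 : ∀ (A : EuclideanSpace ℝ (Fin 3) →L[ℝ] EuclideanSpace ℝ (Fin 3)), (∀ x, inner ℝ (A x) x = 0) →
      ∀ (U : EuclideanSpace ℝ (Fin 3) → EuclideanSpace ℝ (Fin 3)) (P : EuclideanSpace ℝ (Fin 3) → ℝ),
        ContDiff ℝ ∞ U → ContDiff ℝ 1 P → VectorCalculus.IsDivFree U →
        (∀ y, -((Δ U) y) + (1 / 2 : ℝ) • U y + (1 / 2 : ℝ) • fderiv ℝ U y (y + A y)
            - (1 / 2 : ℝ) • A (U y) + convect U U y + gradient P y = 0) →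
        (∃ K : ℝ, ∀ y, ‖U y‖ ≤ K / (‖y‖ + 1)) → U = 0) :
    SpiralScalingLiouville :=
  rotatedProfileLiouville_iff_spiralScalingLiouville.1 h2

end Summit.NavierStokesRegularity.NavierStokesRegularity.Theorems

end
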